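import Summits.QuantumFields.YangMills.Theorems.AllWindowsColdBoxBoxHighLineTiltUEvenL2
import Summits.QuantumFields.YangMills.Theorems.AllWindowsColdBoxBoxHighLineCubicVertexPoly
import Mathlib.Algebra.Order.Chebyshev

/-!
# U5-L3-concrete STAGE 2, PRELIMINARIES — tools for the HIGHER restricted-Gaussian moments `E₀[1_D·(tiltU − b)^{2k}]` of the tilt exponent
# (the `U`-slots `RU₂/RU₄/RU₆` of ✓`GaussNormalForm.abs_tiltCum5_muD_le_of_sizes`, `Cruxes/BoxWindowHighSU2213/U5-BLOCKERS.md` §2 L3; LINE-20 U5 ⟨stmt-QuantumFields-24336⟩)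

Width seat `ym-line-sfw-p2-w5` (prover-ym-line-sfw-p2-w5-g24-0), continuing fcl-p3 g26's ✓`…TiltCum5Sizes` («STAGE 2: discharge RU₄, RU₆»).  The second moment
✓13K-U (`…TiltUEvenL2`) dominated `(U + V₃ − b)²` by ONE integrable majorant; for the `2k`-th moments the even-part fluctuations are NOT sup-bounded
(fcl-p3's NB: `sup_D W₄ ≍ βH⁴s⁴` loses `β^{4κ₃}`) but treated as POLYNOMIALS under Gaussian hypercontractivity.  This file supplies the generic pieces:

* §1 `abs_pow_le_of_abs_le_sum_eight` — the power mean `|x|^{n+1} ≤ 8^n·Σ_{i<8} y_i^{n+1}` for `|x| ≤ Σ y_i`, `y_i ≥ 0` (Mathlib's `pow_sum_le_card_mul_sum_pow`);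
* §2 ✓`polyCert` certificates (LEAD's ✓`EdgeChartGaussian.polyCert_*` algebra): the plaquette edge energy `S_p = Σ_i‖v_{p,i}‖²` (deg 2, ✓`PlaqObsL2.polyDeg_edgeSq`),
  `‖a_e‖²` (deg 2), the WILSON dominator `G_W = Σ_{p touching} S_p²` (deg 4), the Φ dominator `G_Φ = Σ_{x int}(Σ_e|g_xe|‖a_e‖²)²` (deg 4), `quadVal M − c` (deg 2);
* §3 second moments `E₀[G_W²] ≤ 9720²·C₈·H⁸/β⁴`, `E₀[G_Φ²] ≤ 2²⁰·C₈·H⁸/β⁴` (`C₈ = 81·(60·1036²)²`, ✓`PlaqObsL2.gaussAvg_edgeSq_pow_four_le` via ✓12c's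
  `QuarticL2Proof.gaussAvg_wilson_majorant_le` / `gaussAvg_phi_majorant_le`);
* §4 `gaussAvg_pow_even_le_of_polyCert_of_le` — `E₀[F²] ≤ B ⇒ E₀[F^{2k}] ≤ (2k−1)^{kd}·B^k` (w5 g23's ✓`gaussAvg_pow_even_le_of_polyCert`);
* §5 pointwise dominators `|quarticWilson| ≤ |β|·√(C₇²+144)·G_W` (✓7a + ✓`PlaqObsL2.evenRem_sq_le`) and `|Φ(U(a)) − divLinSq| ≤ C_Φ·G_Φ` (✓7b clause 2), EVERY field.

Tree + Mathlib; no definitions; standard axioms.  HONEST LABEL: U5 prep, helper-grade tools for the recorded lift L3 of the NEXT rung U5 (⟨24336⟩ UNSTAFFED);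
⟨24004⟩ ⟨24336⟩ OPEN; route AllWindowsColdBox DRAFT; no crux, rung or summit is proved; **the Yang–Mills mass gap is NOT proved by this file; no summit is
proved by a line.**
-/

set_option autoImplicit false

noncomputable section

open MeasureTheory Matrix Finset
open scoped Kronecker
open Literature.Probability.LatticeModels (Site)
open Literature.MathematicalPhysics.QuantumLattice (plaquettesTouching)
open Literature.MathematicalPhysics.QuantumFieldTheory.AxialGauge (boxEdges)

namespace Summit.QuantumFields.YangMills.Theorems.AllWindowsColdBoxBoxHighLine

namespace GaussNormalForm

open EdgeChartGaussian (integrable_gaussWeight gaussAvg_mono_of_nonneg gaussAvg_nonneg gaussAvg_const_fun polyCert_const polyCert_coord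
  polyCert_add polyCert_sub polyCert_const_mul polyCert_mul polyCert_pow polyCert_sum polyCert_mono integrable_polyCert_mul_gaussWeight
  gaussAvg_pow_even_le_of_polyCert)
open LaplaceSandwich (flatten flatten_apply)

variable {H : ℕ} {β : ℝ}

/-! ## §1 The eight-term power mean -/

/-- **Power mean, eight terms**: if `|x| ≤ y₁ + ⋯ + y₈` with all `y_i ≥ 0`, then `|x|^{n+1} ≤ 8^n·(y₁^{n+1} + ⋯ + y₈^{n+1})`. -/
theorem abs_pow_le_of_abs_le_sum_eight {x y₁ y₂ y₃ y₄ y₅ y₆ y₇ y₈ : ℝ} (h₁ : 0 ≤ y₁) (h₂ : 0 ≤ y₂) (h₃ : 0 ≤ y₃) (h₄ : 0 ≤ y₄)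
    (h₅ : 0 ≤ y₅) (h₆ : 0 ≤ y₆) (h₇ : 0 ≤ y₇) (h₈ : 0 ≤ y₈) (hx : |x| ≤ y₁ + y₂ + y₃ + y₄ + y₅ + y₆ + y₇ + y₈) (n : ℕ) :
    |x| ^ (n + 1) ≤ 8 ^ n * (y₁ ^ (n + 1) + y₂ ^ (n + 1) + y₃ ^ (n + 1) + y₄ ^ (n + 1) + y₅ ^ (n + 1) + y₆ ^ (n + 1) + y₇ ^ (n + 1) + y₈ ^ (n + 1)) := by
  have hf : ∀ i ∈ (Finset.univ : Finset (Fin 8)), 0 ≤ (![y₁, y₂, y₃, y₄, y₅, y₆, y₇, y₈] : Fin 8 → ℝ) i := by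
    intro i _
    fin_cases i <;> simp <;> assumption
  have h := pow_sum_le_card_mul_sum_pow hf n
  simp only [Finset.card_univ, Fintype.card_fin, Fin.sum_univ_eight] at h
  simp only [Matrix.cons_val_zero, Matrix.cons_val_one, Matrix.cons_val] at h
  have hs0 : 0 ≤ y₁ + y₂ + y₃ + y₄ + y₅ + y₆ + y₇ + y₈ := by positivity
  calc |x| ^ (n + 1) ≤ (y₁ + y₂ + y₃ + y₄ + y₅ + y₆ + y₇ + y₈) ^ (n + 1) := pow_le_pow_left₀ (abs_nonneg x) hx _
    _ ≤ _ := by exact_mod_cast h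

/-! ## §2 Polynomial certificates -/

/-- ★ The plaquette edge energy `S_p(a) = Σ_{i<4} ‖plaqVar H x μ ν a i‖²` is a certified polynomial of degree `≤ 2`. -/
theorem polyCert_edgeSq (H : ℕ) (x : Site 4) (μ ν : Fin 4) :
    ∃ Q : MvPolynomial (LandauFree H × Fin 3) ℝ, Q.totalDegree ≤ 2 ∧
      ∀ a : LandauFree H → E3, (∑ i : Fin 4, ‖plaqVar H x μ ν a i‖ ^ 2) = MvPolynomial.eval (flatten (LandauFree H) a) Q := by
  obtain ⟨Q, hQ, h⟩ := PlaqObsL2.polyDeg_edgeSq H x μ ν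
  exact ⟨Q, hQ, fun a => by rw [PlaqObsL2.edgeSq_eq_flat, h]⟩

/-- `‖a_e‖²` is a certified polynomial of degree `≤ 2`. -/
theorem polyCert_normSq (e : LandauFree H) :
    ∃ Q : MvPolynomial (LandauFree H × Fin 3) ℝ, Q.totalDegree ≤ 2 ∧ ∀ a : LandauFree H → E3, ‖a e‖ ^ 2 = MvPolynomial.eval (flatten (LandauFree H) a) Q := by
  have h : ∀ c ∈ (Finset.univ : Finset (Fin 3)), ∃ Q : MvPolynomial (LandauFree H × Fin 3) ℝ, Q.totalDegree ≤ 2 ∧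
      ∀ a : LandauFree H → E3, a e c ^ 2 = MvPolynomial.eval (flatten (LandauFree H) a) Q := by
    intro c _
    have h := polyCert_pow (polyCert_coord e c (le_refl 1)) 2
    simpa only [mul_one] using h
  obtain ⟨Q, hQ, hQ'⟩ := polyCert_sum Finset.univ h
  refine ⟨Q, hQ, fun a => ?_⟩
  rw [LaplaceSandwich.norm_sq_eq_sum]
  simp only [flatten_apply]
  exact hQ' a

/-- ★ The WILSON dominator `G_W(a) = Σ_{p touching the box} S_p(a)²` is a certified polynomial of degree `≤ 4`. -/
theorem polyCert_wilsonG (H : ℕ) :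
    ∃ Q : MvPolynomial (LandauFree H × Fin 3) ℝ, Q.totalDegree ≤ 4 ∧ ∀ a : LandauFree H → E3,
      (∑ p ∈ plaquettesTouching (boxEdges 4 (2 * H + 1)), (∑ i : Fin 4, ‖plaqVar H p.1 p.2.1.1 p.2.1.2 a i‖ ^ 2) ^ 2) =
        MvPolynomial.eval (flatten (LandauFree H) a) Q := by
  refine polyCert_sum _ fun p _ => ?_
  have h := polyCert_pow (polyCert_edgeSq H p.1 p.2.1.1 p.2.1.2) 2
  exact h

/-- The site weight `A_x(a) = Σ_e |g_xe|·‖a_e‖²` is a certified polynomial of degree `≤ 2`. -/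
theorem polyCert_siteWeight (H : ℕ) (x : Site 4) :
    ∃ Q : MvPolynomial (LandauFree H × Fin 3) ℝ, Q.totalDegree ≤ 2 ∧ ∀ a : LandauFree H → E3,
      (∑ e : LandauFree H, |gradVec H x e| * ‖a e‖ ^ 2) = MvPolynomial.eval (flatten (LandauFree H) a) Q :=
  polyCert_sum _ fun e _ => polyCert_const_mul _ (polyCert_normSq e)

/-- ★ The Φ dominator `G_Φ(a) = Σ_{x interior} A_x(a)²` is a certified polynomial of degree `≤ 4`. -/
theorem polyCert_phiG (H : ℕ) :
    ∃ Q : MvPolynomial (LandauFree H × Fin 3) ℝ, Q.totalDegree ≤ 4 ∧ ∀ a : LandauFree H → E3,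
      (∑ x ∈ interiorSites H, (∑ e : LandauFree H, |gradVec H x e| * ‖a e‖ ^ 2) ^ 2) = MvPolynomial.eval (flatten (LandauFree H) a) Q := by
  refine polyCert_sum _ fun x _ => ?_
  have h := polyCert_pow (polyCert_siteWeight H x) 2
  exact h

/-- A centred quadratic form `quadVal M a − c` is a certified polynomial of degree `≤ 2` (✓`polyDeg_quadForm`, ✓`QuadFluct.quadVal_eq_flat`). -/
theorem polyCert_quadVal_sub (M : Matrix (LandauFree H × Fin 3) (LandauFree H × Fin 3) ℝ) (c : ℝ) :
    ∃ Q : MvPolynomial (LandauFree H × Fin 3) ℝ, Q.totalDegree ≤ 2 ∧ ∀ a : LandauFree H → E3,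
      quadVal M a - c = MvPolynomial.eval (flatten (LandauFree H) a) Q := by
  obtain ⟨Q, hQ, h⟩ := polyDeg_quadForm M
  have hq : ∃ Q : MvPolynomial (LandauFree H × Fin 3) ℝ, Q.totalDegree ≤ 2 ∧ ∀ a : LandauFree H → E3,
      quadVal M a = MvPolynomial.eval (flatten (LandauFree H) a) Q :=
    ⟨Q, hQ, fun a => by rw [QuadFluct.quadVal_eq_flat, h]⟩
  exact polyCert_sub hq (polyCert_const c 2)

/-! ## §3 Second moments of the two quartic dominators -/

/-- ★ **`E₀[G_W²] ≤ 9720²·C₈·H⁸/β⁴`** (`G_W² ≤ #PT·Σ_p S_p⁴` and ✓`gaussAvg_edgeSq_pow_four_le`, `#PT ≤ 9720H⁴`). -/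
theorem gaussAvg_wilsonG_sq_le (hH : 1 ≤ H) (hβ : 0 < β) :
    gaussAvg β H (fun a => (∑ p ∈ plaquettesTouching (boxEdges 4 (2 * H + 1)), (∑ i : Fin 4, ‖plaqVar H p.1 p.2.1.1 p.2.1.2 a i‖ ^ 2) ^ 2) ^ 2) ≤
      9720 ^ 2 * (81 * (60 * 1036 ^ 2) ^ 2) * (H : ℝ) ^ 8 / β ^ 4 := by
  set PT := plaquettesTouching (boxEdges 4 (2 * H + 1)) with hPT
  have hPTle : (PT.card : ℝ) ≤ 9720 * (H : ℝ) ^ 4 := QuarticL2Proof.card_touching_le hH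
  have hPT0 : (0 : ℝ) ≤ PT.card := Nat.cast_nonneg _
  -- pointwise Cauchy–Schwarz
  have hdom : ∀ a : LandauFree H → E3, (∑ p ∈ PT, (∑ i : Fin 4, ‖plaqVar H p.1 p.2.1.1 p.2.1.2 a i‖ ^ 2) ^ 2) ^ 2 ≤
      (PT.card : ℝ) * ∑ p ∈ PT, (∑ i : Fin 4, ‖plaqVar H p.1 p.2.1.1 p.2.1.2 a i‖ ^ 2) ^ 4 := by
    intro a
    have h := sq_sum_le_card_mul_sum_sq (s := PT) (f := fun p => (∑ i : Fin 4, ‖plaqVar H p.1 p.2.1.1 p.2.1.2 a i‖ ^ 2) ^ 2)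
    refine h.trans (le_of_eq ?_)
    congr 1
    refine Finset.sum_congr rfl fun p _ => ?_
    ring
  calc gaussAvg β H (fun a => (∑ p ∈ PT, (∑ i : Fin 4, ‖plaqVar H p.1 p.2.1.1 p.2.1.2 a i‖ ^ 2) ^ 2) ^ 2)
      ≤ gaussAvg β H (fun a => (PT.card : ℝ) * ∑ p ∈ PT, (∑ i : Fin 4, ‖plaqVar H p.1 p.2.1.1 p.2.1.2 a i‖ ^ 2) ^ 4) :=
        gaussAvg_mono_of_nonneg H hβ (fun a => sq_nonneg _) hdom (QuarticL2Proof.integrable_wilson_majorant H hβ _)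
    _ ≤ (PT.card : ℝ) * (PT.card * (81 * (60 * 1036 ^ 2) ^ 2 / β ^ 4)) := QuarticL2Proof.gaussAvg_wilson_majorant_le H hβ hPT0
    _ = (81 * (60 * 1036 ^ 2) ^ 2) * (PT.card : ℝ) ^ 2 / β ^ 4 := by ring
    _ ≤ (81 * (60 * 1036 ^ 2) ^ 2) * (9720 * (H : ℝ) ^ 4) ^ 2 / β ^ 4 := by
        have h2 : (PT.card : ℝ) ^ 2 ≤ (9720 * (H : ℝ) ^ 4) ^ 2 := pow_le_pow_left₀ hPT0 hPTle 2
        exact div_le_div_of_nonneg_right (mul_le_mul_of_nonneg_left h2 (by positivity)) (by positivity)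
    _ = 9720 ^ 2 * (81 * (60 * 1036 ^ 2) ^ 2) * (H : ℝ) ^ 8 / β ^ 4 := by ring

/-- ★ **`E₀[G_Φ²] ≤ 2²⁰·C₈·H⁸/β⁴`** (`G_Φ² ≤ |X|·Σ_x A_x⁴`, `A_x⁴ ≤ 512·Σ_e|g_xe|‖a_e‖⁸ ≤ 512·Σ_e|g_xe|S_e⁴`, ✓`gaussAvg_phi_majorant_le`, `|X| ≤ 16H⁴`). -/
theorem gaussAvg_phiG_sq_le (hβ : 0 < β) :
    gaussAvg β H (fun a => (∑ x ∈ interiorSites H, (∑ e : LandauFree H, |gradVec H x e| * ‖a e‖ ^ 2) ^ 2) ^ 2) ≤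
      2 ^ 20 * (81 * (60 * 1036 ^ 2) ^ 2) * (H : ℝ) ^ 8 / β ^ 4 := by
  have hX := PhiTaylorProof.card_interiorSites_le H
  have hX0 : (0 : ℝ) ≤ (interiorSites H).card := Nat.cast_nonneg _
  -- pointwise: `(Σ_x A_x²)² ≤ |X|·512·Σ_x Σ_e |g_xe| S_e⁴`
  have hdom : ∀ a : LandauFree H → E3, (∑ x ∈ interiorSites H, (∑ e : LandauFree H, |gradVec H x e| * ‖a e‖ ^ 2) ^ 2) ^ 2 ≤
      ((interiorSites H).card * 512 : ℝ) * ∑ x ∈ interiorSites H, ∑ e : LandauFree H,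
        |gradVec H x e| * (∑ j : Fin 4, ‖plaqVar H e.1.1.1 e.1.1.2 e.1.1.2 a j‖ ^ 2) ^ 4 := by
    intro a
    have h1 := sq_sum_le_card_mul_sum_sq (s := interiorSites H) (f := fun x => (∑ e : LandauFree H, |gradVec H x e| * ‖a e‖ ^ 2) ^ 2)
    have h2 : ∀ x ∈ interiorSites H, ((∑ e : LandauFree H, |gradVec H x e| * ‖a e‖ ^ 2) ^ 2) ^ 2 ≤
        512 * ∑ e : LandauFree H, |gradVec H x e| * (∑ j : Fin 4, ‖plaqVar H e.1.1.1 e.1.1.2 e.1.1.2 a j‖ ^ 2) ^ 4 := by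
      intro x hx
      rw [← pow_mul]
      refine (QuarticL2Proof.site_weight_pow_four_le hx a).trans (mul_le_mul_of_nonneg_left ?_ (by norm_num))
      exact Finset.sum_le_sum fun e _ => mul_le_mul_of_nonneg_left (QuarticL2Proof.norm_pow_eight_le_edgeSq_pow_four a e) (abs_nonneg _)
    calc (∑ x ∈ interiorSites H, (∑ e : LandauFree H, |gradVec H x e| * ‖a e‖ ^ 2) ^ 2) ^ 2
        ≤ (interiorSites H).card * ∑ x ∈ interiorSites H, ((∑ e : LandauFree H, |gradVec H x e| * ‖a e‖ ^ 2) ^ 2) ^ 2 := h1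
      _ ≤ (interiorSites H).card * ∑ x ∈ interiorSites H,
            (512 * ∑ e : LandauFree H, |gradVec H x e| * (∑ j : Fin 4, ‖plaqVar H e.1.1.1 e.1.1.2 e.1.1.2 a j‖ ^ 2) ^ 4) :=
          mul_le_mul_of_nonneg_left (Finset.sum_le_sum h2) hX0
      _ = ((interiorSites H).card * 512 : ℝ) * ∑ x ∈ interiorSites H, ∑ e : LandauFree H,
            |gradVec H x e| * (∑ j : Fin 4, ‖plaqVar H e.1.1.1 e.1.1.2 e.1.1.2 a j‖ ^ 2) ^ 4 := by
          rw [← Finset.mul_sum]; ring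
  have hK : (0 : ℝ) ≤ (interiorSites H).card * 512 := by positivity
  calc gaussAvg β H (fun a => (∑ x ∈ interiorSites H, (∑ e : LandauFree H, |gradVec H x e| * ‖a e‖ ^ 2) ^ 2) ^ 2)
      ≤ gaussAvg β H (fun a => ((interiorSites H).card * 512 : ℝ) * ∑ x ∈ interiorSites H, ∑ e : LandauFree H,
          |gradVec H x e| * (∑ j : Fin 4, ‖plaqVar H e.1.1.1 e.1.1.2 e.1.1.2 a j‖ ^ 2) ^ 4) :=
        gaussAvg_mono_of_nonneg H hβ (fun a => sq_nonneg _) hdom (QuarticL2Proof.integrable_phi_majorant hβ _)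
    _ ≤ ((interiorSites H).card * 512 : ℝ) * ((interiorSites H).card * (8 * (81 * (60 * 1036 ^ 2) ^ 2 / β ^ 4))) :=
        QuarticL2Proof.gaussAvg_phi_majorant_le hβ hK
    _ = 4096 * (81 * (60 * 1036 ^ 2) ^ 2) * ((interiorSites H).card : ℝ) ^ 2 / β ^ 4 := by ring
    _ ≤ 4096 * (81 * (60 * 1036 ^ 2) ^ 2) * (16 * (H : ℝ) ^ 4) ^ 2 / β ^ 4 := by
        have h2 : ((interiorSites H).card : ℝ) ^ 2 ≤ (16 * (H : ℝ) ^ 4) ^ 2 := pow_le_pow_left₀ hX0 hX 2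
        exact div_le_div_of_nonneg_right (mul_le_mul_of_nonneg_left h2 (by positivity)) (by positivity)
    _ = 2 ^ 20 * (81 * (60 * 1036 ^ 2) ^ 2) * (H : ℝ) ^ 8 / β ^ 4 := by ring

/-! ## §4 Even moments from a second-moment bound -/

/-- ★ **Hypercontractivity with a variance bound plugged in**: for a certified polynomial `F` of degree `≤ d` with `E₀[F²] ≤ B` and `k ≥ 1`,
`E₀[F^{2k}] ≤ (2k−1)^{k·d} · B^k`. -/
theorem gaussAvg_pow_even_le_of_polyCert_of_le (H : ℕ) (hβ : 0 < β) {F : (LandauFree H → E3) → ℝ} {d : ℕ}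
    (hF : ∃ Q : MvPolynomial (LandauFree H × Fin 3) ℝ, Q.totalDegree ≤ d ∧ ∀ a, F a = MvPolynomial.eval (flatten (LandauFree H) a) Q)
    {B : ℝ} (hB : gaussAvg β H (fun a => F a ^ 2) ≤ B) (k : ℕ) (hk : 1 ≤ k) :
    gaussAvg β H (fun a => F a ^ (2 * k)) ≤ (2 * k - 1 : ℝ) ^ (k * d) * B ^ k := by
  have h := gaussAvg_pow_even_le_of_polyCert H hβ hF k hk
  have h0 : 0 ≤ gaussAvg β H (fun a => F a ^ 2) := gaussAvg_nonneg H hβ fun a => sq_nonneg _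
  have hk1 : (0 : ℝ) ≤ 2 * k - 1 := by
    have : (1 : ℝ) ≤ k := by exact_mod_cast hk
    linarith
  exact h.trans (mul_le_mul_of_nonneg_left (pow_le_pow_left₀ h0 hB k) (pow_nonneg hk1 _))

/-! ## §5 Pointwise dominators of the two quartic pieces, every field -/

/-- ★ **`|quarticWilson β H a| ≤ |β|·√(C₇² + 144)·G_W(a)`** for EVERY field (✓7a `wilsonPlaquetteTaylor`, ✓`PlaqObsL2.evenRem_sq_le`:
`R_p² ≤ (C₇²+144)·S_p⁴`, hence `|R_p| ≤ √(C₇²+144)·S_p²`). -/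
theorem abs_quarticWilson_le_wilsonG : ∃ K : ℝ, 0 ≤ K ∧ ∀ (β : ℝ) (H : ℕ) (a : LandauFree H → E3),
    |quarticWilson β H a| ≤ |β| * K * ∑ p ∈ plaquettesTouching (boxEdges 4 (2 * H + 1)), (∑ i : Fin 4, ‖plaqVar H p.1 p.2.1.1 p.2.1.2 a i‖ ^ 2) ^ 2 := by
  obtain ⟨C₇, hC₇⟩ := wilsonPlaquetteTaylor
  refine ⟨Real.sqrt (C₇ ^ 2 + 144), Real.sqrt_nonneg _, fun β H a => ?_⟩
  set K := Real.sqrt (C₇ ^ 2 + 144) with hK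
  have hK0 : 0 ≤ K := Real.sqrt_nonneg _
  have hK2 : K ^ 2 = C₇ ^ 2 + 144 := Real.sq_sqrt (by positivity)
  -- each even remainder: `|R_p| ≤ K·S_p²`
  have hR : ∀ p ∈ plaquettesTouching (boxEdges 4 (2 * H + 1)),
      |chartPlaqCost H p.1 p.2.1.1 p.2.1.2 a - linCurvSq H (p.1, p.2.1.1, p.2.1.2) a - chartPlaqCostOdd H p.1 p.2.1.1 p.2.1.2 a| ≤
        K * (∑ i : Fin 4, ‖plaqVar H p.1 p.2.1.1 p.2.1.2 a i‖ ^ 2) ^ 2 := by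
    intro p _
    obtain ⟨T, -, hT⟩ := hC₇ p.2.1.1 p.2.1.2 (ne_of_lt p.2.2)
    have hsq : (chartPlaqCost H p.1 p.2.1.1 p.2.1.2 a - linCurvSq H (p.1, p.2.1.1, p.2.1.2) a - chartPlaqCostOdd H p.1 p.2.1.1 p.2.1.2 a) ^ 2 ≤
        (C₇ ^ 2 + 144) * (∑ i : Fin 4, ‖plaqVar H p.1 p.2.1.1 p.2.1.2 a i‖ ^ 2) ^ 4 := by
      rw [PlaqObsL2.linCurvSq_eq_norm_plaqLin_sq]
      exact PlaqObsL2.evenRem_sq_le H p.1 p.2.1.1 p.2.1.2 (fun t a ht0 ht1 hv => (hT H p.1 t a ht0 ht1 hv).1) a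
    refine abs_le_of_sq_le_sq ?_ (by positivity)
    calc (chartPlaqCost H p.1 p.2.1.1 p.2.1.2 a - linCurvSq H (p.1, p.2.1.1, p.2.1.2) a - chartPlaqCostOdd H p.1 p.2.1.1 p.2.1.2 a) ^ 2
        ≤ (C₇ ^ 2 + 144) * (∑ i : Fin 4, ‖plaqVar H p.1 p.2.1.1 p.2.1.2 a i‖ ^ 2) ^ 4 := hsq
      _ = (K * (∑ i : Fin 4, ‖plaqVar H p.1 p.2.1.1 p.2.1.2 a i‖ ^ 2) ^ 2) ^ 2 := by rw [mul_pow, hK2]; ring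
  unfold quarticWilson
  rw [abs_mul, mul_assoc, Finset.mul_sum]
  refine mul_le_mul_of_nonneg_left ((Finset.abs_sum_le_sum_abs _ _).trans (Finset.sum_le_sum hR)) (abs_nonneg β)

/-- ★ **`|Φ(U(a)) − divLinSq H a| ≤ C_Φ·G_Φ(a)`** for EVERY field, with `C_Φ ≥ 0` (✓7b `phiTaylor`, clause 2). -/
theorem abs_phi_sub_divLinSq_le_phiG : ∃ K : ℝ, 0 ≤ K ∧ ∀ H : ℕ, 1 ≤ H → ∀ a : LandauFree H → E3,
    |landauPhi H (edgeChart H a) - divLinSq H a| ≤ K * ∑ x ∈ interiorSites H, (∑ e : LandauFree H, |gradVec H x e| * ‖a e‖ ^ 2) ^ 2 := by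
  obtain ⟨C, hC⟩ := phiTaylor
  refine ⟨max C 0, le_max_right _ _, fun H hH a => ((hC H hH a).2.1).trans ?_⟩
  exact mul_le_mul_of_nonneg_right (le_max_left _ _) (Finset.sum_nonneg fun x _ => sq_nonneg _)


/-! ## §6 Three small algebraic helpers for the main file `…TiltUMoments` (appended) -/

/-- Triangle inequality, eight terms. -/
theorem abs_add_eight_le (t₁ t₂ t₃ t₄ t₅ t₆ t₇ t₈ : ℝ) :
    |t₁ + t₂ + t₃ + t₄ + t₅ + t₆ + t₇ + t₈| ≤ |t₁| + |t₂| + |t₃| + |t₄| + |t₅| + |t₆| + |t₇| + |t₈| := by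
  have h2 := abs_add_le t₁ t₂
  have h3 := abs_add_le (t₁ + t₂) t₃
  have h4 := abs_add_le (t₁ + t₂ + t₃) t₄
  have h5 := abs_add_le (t₁ + t₂ + t₃ + t₄) t₅
  have h6 := abs_add_le (t₁ + t₂ + t₃ + t₄ + t₅) t₆
  have h7 := abs_add_le (t₁ + t₂ + t₃ + t₄ + t₅ + t₆) t₇
  have h8 := abs_add_le (t₁ + t₂ + t₃ + t₄ + t₅ + t₆ + t₇) t₈
  linarith

/-- The algebraic identity behind the eight-term decomposition of `tiltU − (c_M + c_h)`:
`U − (c_M + c_h) = −(V₃ − F) − F − W₄ − β(Φ − divLinSq) + (g − q_M) + (q_M − c_M) + (h − q_h) + (q_h − c_h)`. -/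
theorem tiltU_sub_eq_eight (β : ℝ) (H : ℕ) (a : LandauFree H → E3) (F qM qh cM ch : ℝ) :
    tiltU β H a - (cM + ch) =
      -(cubicVertex β H a - F) + -F + -quarticWilson β H a + -(β * (landauPhi H (edgeChart H a) - divLinSq H a)) +
        (ghostLogRatio H a - qM) + (qM - cM) + (haarLogRatio H a - qh) + (qh - ch) := by
  unfold tiltU; ring

/-- With `A ∈ [0,1]` (`A = H⁴/β`): `(A²)^k ≤ A^k` — the «`H⁸/β²`-type» terms are dominated by `(H⁴/β)^k`. -/
theorem sq_pow_le_pow_of_le_one {A : ℝ} (hA0 : 0 ≤ A) (hA1 : A ≤ 1) (k : ℕ) : (A ^ 2) ^ k ≤ A ^ k :=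
  pow_le_pow_left₀ (sq_nonneg A) (by nlinarith) k

end GaussNormalForm

end Summit.QuantumFields.YangMills.Theorems.AllWindowsColdBoxBoxHighLine

end
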